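import Literature.Computability.QuantumComplexity.SimonSamplerSpec
import Literature.Computability.QuantumComplexity.SimonBlockFourier
import Literature.Computability.Complexity.GF2KernelProgram
import HarnessLib

/-!
# Simon's algorithm inside a phase-query family, III: the output law of the sampler

Third file of the quantum half of the discharge of
`Literature.Computability.Complexity.fortnowGrochow_Ker_eq_PEq_UP_subset_BQP` (Fortnow–Grochow 2011,
Thm. 4.3 via Simon's algorithm), joining `SimonSamplerSpec.lean` (the family `family (params hF)` on
the padded input `xin a Q r m = xcode a Q r m (m (Q + r))`), `PhaseQueryKernel.lean` (the output law of
phase-query families, the single-query amplitudes) and `SimonBlockFourier.lean` (the block Fourier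
sums `amp`, `S1`, `MissesBasis`):

* `phiFin_apply_of_onePhaseAt'` — the amplitude formula with the number of active wires abstracted;
* the bridge from the machine's strings to vectors: `gHat F a Q r` (`ĝ_a`), `stepBit_ofFn`,
  `block_ofFn_append`, **`sign_Gbit`** (`(-1)^{G(a,u)} = sgnBlk ĝ_a u`), `sgnP_padW`, `chiW_eq_twist`;
* **`phiFin_xin`**: the final block state is `amp ĝ_a` on the contents vanishing off the active wires;
* **`kernelProb_samples`**: for every property `D` of the `m` samples read off the measured string
  (`samples`: block `i`, bit `j` at wire `N + i (Q + r) + j`),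
  `Pr[D] = ∑_v amp ĝ_a v ² [D (ξ v)]`;
* **the two cases of Simon's analysis** (Simon 1997, §3.1): `kernelProb_missesBasis_of_periodic`
  (nonzero xor-mask ⟹ the samples miss a basis with probability `1`) and
  `kernelProb_missesBasis_le_of_injective` (`≤ (2^Q − 1) 2^{(Q−1)m} / 2^{Qm}`),
  `kernelProb_not_missesBasis` (the complement), and the classical test
  `progK_rowsOf : GF2Kernel.progK (rowsOf y) = [MissesBasis y]` (`GF2KernelProgram.lean`).

## References

* D. R. Simon, *On the power of quantum computation*, SIAM J. Comput. 26 (1997) 1474–1483, §3.1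
  [Simon1997].
* L. Fortnow, J. A. Grochow, *Complexity classes of equivalence problems revisited*, Inform. and
  Comput. 209 (2011) = arXiv:0907.4775, Thm. 4.3 [FortnowGrochow2011].
* S. Aaronson, A. Ambainis, *Forrelation*, SIAM J. Comput. 47 (2018), §3.2 (Fig. 2, `k = 1`)
  [AaronsonAmbainis2018].
* M. A. Nielsen, I. L. Chuang, *Quantum Computation and Quantum Information*, CUP 2010, §2.2.5
  [NielsenChuang2010].
-/

noncomputable section

namespace Literature.Computability.QuantumComplexity

open _root_.Computability Complexity Cryptography Finset

namespace SimonSampler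

open PhaseQuery SimonBlocks Simon

/-! ### A variant of the single-query amplitude formula with the number of active wires as a parameter -/

/-- `phiFin_apply_of_onePhaseAt` with the number `W` of active wires abstracted (so that clients can
index the active content by their own expression for `W`). [cite: AaronsonAmbainis2018, §3.2 (Fig. 2, k = 1)] -/
theorem _root_.Literature.Computability.QuantumComplexity.PhaseQuery.phiFin_apply_of_onePhaseAt'
    {P : Params} {S : Spec P} {x : List Bool} (A : Language Bool) (h : OnePhaseAt P S x) {W : ℕ} (hWv : S.Wv x = W)
    (hW : W ≤ Wq P x.length) (v : QReg (Wq P x.length)) :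
    phiFin P S x A v =
      if (∀ t : Fin (Wq P x.length), W ≤ t.val → v t = false) then
        (1 / 2 : ℂ) ^ W * ∑ u : Fin W → Bool, sgnP P S x 1 (padW (Wq P x.length) u) * chiW hW u v
      else 0 := by
  subst hWv
  exact phiFin_apply_of_onePhaseAt A h v

/-! ### The block function and the bridge from the string level to the vector level -/

section Bridge

variable (F : List Bool → List Bool) (a : List Bool) (Q r m : ℕ)

/-- **The block function `ĝ_a`**: `y ↦ codeR r (F ⟨a, y⟩)` as a vector of `r` bits.
[cite: FortnowGrochow2011, Thm. 4.3 (proof: `f_a(x) = f(a, x)`)] -/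
def gHat (y : Fin Q → Bool) : Fin r → Bool := fun k => (codeR r (F (boolPair a (List.ofFn y)))).getD k false

/-- `gHat` lists the value code. [folklore] -/
theorem ofFn_gHat (y : Fin Q → Bool) : List.ofFn (gHat F a Q r y) = codeR r (F (boolPair a (List.ofFn y))) := by
  apply List.ext_getElem (by simp)
  intro k h₁ h₂
  rw [List.getElem_ofFn, gHat, List.getD_eq_getElem?_getD, List.getElem?_eq_getElem h₂, Option.getD_some]

/-- The two parts of a block, as lists. [folklore] -/
theorem ofFn_block (b : Fin (Q + r) → Bool) : (List.ofFn b).take Q = List.ofFn (yOf b) ∧ (List.ofFn b).drop Q = List.ofFn (zOf b) := by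
  rw [List.ofFn_add]
  constructor
  · rw [List.take_append_of_le_length (by simp), List.take_of_length_le (by simp)]; rfl
  · rw [List.drop_append_of_le_length (by simp), List.drop_of_length_le (by simp), List.nil_append]; rfl

/-- **The block bit on a genuine block** is the oddness of the overlap `z · ĝ_a(y)`. [cite: Simon1997, §3.1] -/
theorem stepBit_ofFn (b : Fin (Q + r) → Bool) : stepBit F a Q r (List.ofFn b) = !decide (EvenOverlap (zOf b) (gHat F a Q r (yOf b))) := by
  obtain ⟨h1, h2⟩ := ofFn_block Q r b
  rw [stepBit, h1, h2, ← ofFn_gHat, ipEven, evenIpFn_ofFn]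
  rfl

/-- Block `i` of a padded content, as a list, is `blk`. [folklore] -/
theorem block_ofFn_append (u : Fin (m * (Q + r)) → Bool) (pad : List Bool) (i : Fin m) :
    ((List.ofFn u ++ pad).drop (i * (Q + r))).take (Q + r) = List.ofFn (blk u i) := by
  have hle : (i : ℕ) * (Q + r) + (Q + r) ≤ m * (Q + r) := by
    have := i.isLt; calc (i : ℕ) * (Q + r) + (Q + r) = (i + 1) * (Q + r) := by ring
      _ ≤ m * (Q + r) := Nat.mul_le_mul_right _ (by omega)
  apply List.ext_getElem
  · simp; omega
  · intro j h₁ h₂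
    simp only [List.length_ofFn] at h₂
    rw [List.getElem_take, List.getElem_drop, List.getElem_append_left (by simp; omega), List.getElem_ofFn, List.getElem_ofFn, blk]
    congr 1
    apply Fin.ext
    simp [finProdFinEquiv, Nat.mul_comm]
    ring

/-- Signs multiply along a xor-fold. [folklore] -/
theorem sign_foldr_xor {α : Type} (f : α → Bool) : ∀ (l : List α) (b : Bool),
    (if l.foldr (fun a acc => xor (f a) acc) b then (-1 : ℝ) else 1) = (l.map fun a => if f a then (-1 : ℝ) else 1).prod * (if b then -1 else 1)
  | [], b => by simp
  | a :: l, b => by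
    rw [List.foldr_cons, List.map_cons, List.prod_cons, mul_assoc, ← sign_foldr_xor f l b]
    cases f a <;> cases l.foldr (fun a acc => xor (f a) acc) b <;> simp

/-- **The phase bit of a padded genuine content is the block sign**: `(-1)^{G(a,u)} = sgnBlk ĝ_a u`.
[cite: Simon1997, §3.1] -/
theorem sign_Gbit (u : Fin (m * (Q + r)) → Bool) (pad : List Bool) :
    (if Gbit F a Q r m (List.ofFn u ++ pad) then (-1 : ℝ) else 1) = sgnBlk (gHat F a Q r) u := by
  rw [Gbit, sign_foldr_xor, if_neg Bool.false_ne_true, mul_one, ← List.map_coe_finRange_eq_range, List.map_map, ← List.ofFn_eq_map,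
    List.prod_ofFn, sgnBlk]
  refine Finset.prod_congr rfl fun i _ => ?_
  simp only [Function.comp_apply]
  rw [block_ofFn_append, stepBit_ofFn, twist_comm]
  by_cases h : EvenOverlap (gHat F a Q r (yOf (blk u i))) (zOf (blk u i))
  · rw [(twist_eq_one_iff _ _).2 h]
    have h' : EvenOverlap (zOf (blk u i)) (gHat F a Q r (yOf (blk u i))) := by unfold EvenOverlap at h ⊢; simpa [Bool.and_comm] using h
    simp [h']
  · rw [(twist_eq_neg_one_iff _ _).2 h]
    have h' : ¬ EvenOverlap (zOf (blk u i)) (gHat F a Q r (yOf (blk u i))) := by unfold EvenOverlap at h ⊢; simpa [Bool.and_comm] using h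
    simp [h']

end Bridge

/-! ### The final block state and the output law of the Simon sampler -/

section Law

variable {F : List Bool → List Bool} (hF : F ∈ FP) (a : List Bool) (Q r m : ℕ) (A : Language Bool)

/-- **The input to the family**: the instance padded with its parameters and `W = m (Q + r)` zeros.
[cite: FortnowGrochow2011, Thm. 4.3 (proof)] -/
abbrev xin : List Bool := xcode a Q r m (m * (Q + r))

/-- The active wires fit in the input. [folklore] -/
theorem W_le_length_xin : m * (Q + r) ≤ (xin a Q r m).length := by rw [length_xcode]; omega

/-- The active wires fit in the register. [folklore] -/
theorem W_le_Wq : m * (Q + r) ≤ Wq (params hF) (xin a Q r m).length := by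
  rw [(Ly_params hF _).2]; have := W_le_length_xin a Q r m; omega

/-- The input is nonempty. [folklore] -/
theorem one_le_length_xin : 1 ≤ (xin a Q r m).length := by rw [length_xcode]; omega

/-- **The phase sign at layer `1` of a padded content is the block sign** `sgnBlk ĝ_a`.
[cite: Simon1997, §3.1] -/
theorem sgnP_padW (u : Fin (m * (Q + r)) → Bool) :
    sgnP (params hF) (spec hF) (xin a Q r m) 1 (padW (Wq (params hF) (xin a Q r m).length) u) = ((sgnBlk (gHat F a Q r) u : ℝ) : ℂ) := by
  rw [sgnP, show (spec hF).Pf = Pf F from rfl, ofFn_padW (W_le_Wq hF a Q r m), Pf_xcode]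
  simp only [decide_true, Bool.true_and]
  rw [← sign_Gbit F a Q r m u (List.replicate (Wq (params hF) (xin a Q r m).length - m * (Q + r)) false)]
  split_ifs <;> simp

/-- `chiW` is the twist with the active part. [folklore] -/
theorem chiW_eq_twist {W K : ℕ} (hW : W ≤ K) (u : Fin W → Bool) (v : QReg K) :
    chiW hW u v = ((twist u (fun i => v (Fin.castLE hW i)) : ℝ) : ℂ) := by
  rw [chiW, twist, Complex.ofReal_prod]
  exact Finset.prod_congr rfl fun i _ => by split_ifs <;> simp

/-- The active part of a register content. [folklore] -/
abbrev act (v : QReg (Wq (params hF) (xin a Q r m).length)) : Fin (m * (Q + r)) → Bool := fun i => v (Fin.castLE (W_le_Wq hF a Q r m) i)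

/-- **The final block state of the Simon sampler**: zero unless the inactive wires read `0`, and then the
real amplitude `amp ĝ_a` of the active part (`SimonBlockFourier.lean`). [cite: Simon1997, §3.1] -/
theorem phiFin_xin (v : QReg (Wq (params hF) (xin a Q r m).length)) :
    phiFin (params hF) (spec hF) (xin a Q r m) A v =
      if (∀ t : Fin (Wq (params hF) (xin a Q r m).length), m * (Q + r) ≤ t.val → v t = false) then
        ((amp (gHat F a Q r) (act hF a Q r m v) : ℝ) : ℂ) else 0 := by
  rw [phiFin_apply_of_onePhaseAt' A (onePhaseAt_xcode hF a Q r m _) (Wv_spec_xcode hF a Q r m _) (W_le_Wq hF a Q r m)]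
  split_ifs with h
  · rw [amp, Complex.ofReal_mul, Complex.ofReal_sum]
    simp_rw [sgnP_padW, chiW_eq_twist, Complex.ofReal_mul]
    push_cast; rfl
  · rfl

/-- **The samples read off a measured output string** `w` of the family on `xin`: block `i`, bit `j` of
the first register sits at wire `N + (i (Q + r) + j)`. [folklore] -/
def samples (N Q r m : ℕ) (w : List Bool) : Fin m → Fin Q → Bool :=
  fun i j => w.getD (N + (finProdFinEquiv (i, Fin.castAdd r j) : Fin (m * (Q + r))).val) false

/-- `kernelProb` of the whole space is `1`. [folklore] -/
theorem kernelProb_univ (Fam : QCircuitFamily cliffordT) (x : List Bool) : Fam.kernelProb A x Set.univ = 1 := by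
  unfold QCircuitFamily.kernelProb
  rw [((Fam.kernel A x).toOuterMeasure_apply_eq_one_iff _).2 (Set.subset_univ _)]; rfl

/-- **The output law of the Simon sampler**: for every property `D` of the `m` samples,
`Pr[D] = ∑_{v ∈ {0,1}^W} amp ĝ_a v ² [D (ξ v)]`. [cite: Simon1997, §3.1] [cite: NielsenChuang2010, §2.2.5] -/
theorem kernelProb_samples (D : (Fin m → Fin Q → Bool) → Prop) [DecidablePred D] :
    (family (params hF)).kernelProb A (xin a Q r m) {w | D (samples (xin a Q r m).length Q r m w)} =
      ∑ v : Fin (m * (Q + r)) → Bool, amp (gHat F a Q r) v ^ 2 * (if D (ξs v) then 1 else 0) := by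
  set P := params hF
  set S := spec hF
  set x := xin a Q r m
  have hW := W_le_Wq hF a Q r m
  -- the event read through the first register
  have hset : {w | D (samples x.length Q r m w)} = {w | D (ξs fun i => (fun t : Fin (Wq P x.length) => w.getD (qW P x.length 0 t) false) (Fin.castLE hW i))} := by
    ext w; simp only [Set.mem_setOf_eq, qW_zero, Fin.val_castLE]; exact Iff.rfl
  rw [hset, kernelProb_family_reg0 P S x A (one_le_length_xin a Q r m) (fun v => D (ξs fun i => v (Fin.castLE hW i)))]
  -- the kernel lemma is stated with the classical decidability instance
  have hnorm : (∑ v : QReg (Wq P x.length), ‖phiFin P S x A v‖ ^ 2 *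
      @ite ℝ (D (ξs fun i => v (Fin.castLE hW i))) (Classical.propDecidable _) 1 0) =
      ∑ v : QReg (Wq P x.length), ‖phiFin P S x A v‖ ^ 2 * (if D (ξs fun i => v (Fin.castLE hW i)) then (1 : ℝ) else 0) :=
    Finset.sum_congr rfl fun v _ => by congr
  rw [hnorm]
  -- only the contents vanishing off the active wires contribute
  have hsplit : (∑ v : QReg (Wq P x.length), ‖phiFin P S x A v‖ ^ 2 * (if D (ξs fun i => v (Fin.castLE hW i)) then (1 : ℝ) else 0)) =
      ∑ v ∈ Finset.univ.filter (fun v : QReg (Wq P x.length) => ∀ t : Fin (Wq P x.length), m * (Q + r) ≤ t.val → v t = false),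
        ‖phiFin P S x A v‖ ^ 2 * (if D (ξs fun i => v (Fin.castLE hW i)) then (1 : ℝ) else 0) := by
    symm
    apply Finset.sum_subset (Finset.filter_subset _ _)
    intro v _ hv
    rw [Finset.mem_filter, not_and] at hv
    rw [phiFin_xin, if_neg (hv (Finset.mem_univ _))]; simp
  rw [hsplit]
  refine Finset.sum_nbij' (fun v i => v (Fin.castLE hW i)) (padW (Wq P x.length)) (fun v _ => Finset.mem_univ _)
    (fun u _ => Finset.mem_filter.2 ⟨Finset.mem_univ _, fun t ht => padW_of_le u ht⟩) (fun v hv => ?_) (fun u _ => ?_) (fun v hv => ?_)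
  · funext t
    by_cases ht : t.val < m * (Q + r)
    · simp only [padW, ht, ↓reduceDIte]; rfl
    · rw [padW_of_le _ (not_lt.1 ht), (Finset.mem_filter.1 hv).2 t (not_lt.1 ht)]
  · funext i; simp
  · rw [phiFin_xin, if_pos (Finset.mem_filter.1 hv).2, Complex.norm_real, Real.norm_eq_abs, sq_abs]

/-- **The periodic case: the samples miss a basis with probability `1`.** If `ĝ_a` has the nonzero
xor-mask `s`, all the mass of the output law sits on sample tuples orthogonal to `s`.
[cite: Simon1997, §3.1 ("if `y · s ≢ 0 (mod 2)` the amplitude is `0`")] -/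
theorem kernelProb_missesBasis_of_periodic {s : Fin Q → Bool} (hs : s ≠ fun _ => false)
    (hg : ∀ y, gHat F a Q r (fun i => y i ^^ s i) = gHat F a Q r y) :
    (family (params hF)).kernelProb A (xin a Q r m) {w | MissesBasis (samples (xin a Q r m).length Q r m w)} = 1 := by
  rw [kernelProb_samples hF a Q r m A (fun y => MissesBasis y)]
  have h1 : (∑ v : Fin (m * (Q + r)) → Bool, amp (gHat F a Q r) v ^ 2 * (if MissesBasis (ξs v) then (1 : ℝ) else 0)) =
      ∑ v : Fin (m * (Q + r)) → Bool, amp (gHat F a Q r) v ^ 2 * (if True then (1 : ℝ) else 0) := by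
    refine Finset.sum_congr rfl fun v _ => ?_
    by_cases hv : MissesBasis (ξs v)
    · rw [if_pos hv, if_pos trivial]
    · rw [amp_eq_zero_of_periodic (gHat F a Q r) hs hg hv]; simp
  rw [h1, ← kernelProb_samples hF a Q r m A (fun _ => True)]
  exact kernelProb_univ A _ _

/-- **The injective case: the samples miss a basis with probability at most
`(2^Q − 1) 2^{(Q−1)m} / 2^{Qm}`.** [cite: Simon1997, §3.1 (last paragraph)] -/
theorem kernelProb_missesBasis_le_of_injective (hg : Function.Injective (gHat F a Q r)) :
    (family (params hF)).kernelProb A (xin a Q r m) {w | MissesBasis (samples (xin a Q r m).length Q r m w)} ≤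
      ((2 ^ Q - 1) * 2 ^ ((Q - 1) * m) : ℕ) / (2 : ℝ) ^ (Q * m) := by
  rw [kernelProb_samples hF a Q r m A (fun y => MissesBasis y)]
  simp_rw [mul_ite, mul_one, mul_zero]
  exact sum_amp_sq_missesBasis_of_injective _ hg

/-- **The complementary event.** [folklore] -/
theorem kernelProb_not_missesBasis (hbound : (family (params hF)).kernelProb A (xin a Q r m) {w | MissesBasis (samples (xin a Q r m).length Q r m w)} ≤ 1 / 3) :
    2 / 3 ≤ (family (params hF)).kernelProb A (xin a Q r m) {w | ¬ MissesBasis (samples (xin a Q r m).length Q r m w)} := by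
  have h1 := kernelProb_samples hF a Q r m A (fun y => MissesBasis y)
  have h2 := kernelProb_samples hF a Q r m A (fun y => ¬ MissesBasis y)
  have h3 := kernelProb_samples hF a Q r m A (fun _ => True)
  have h4 : (family (params hF)).kernelProb A (xin a Q r m) {w | True} = 1 := kernelProb_univ A _ _
  have hsum : (∑ v : Fin (m * (Q + r)) → Bool, amp (gHat F a Q r) v ^ 2 * (if MissesBasis (ξs v) then (1 : ℝ) else 0)) +
      (∑ v : Fin (m * (Q + r)) → Bool, amp (gHat F a Q r) v ^ 2 * (if ¬ MissesBasis (ξs v) then (1 : ℝ) else 0)) =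
      ∑ v : Fin (m * (Q + r)) → Bool, amp (gHat F a Q r) v ^ 2 * (if True then (1 : ℝ) else 0) := by
    rw [← Finset.sum_add_distrib]
    refine Finset.sum_congr rfl fun v _ => ?_
    by_cases hv : MissesBasis (ξs v) <;> simp [hv]
  rw [← h1, ← h2, ← h3, h4] at hsum
  linarith

/-! ### The classical decision on the samples -/

/-- The rows handed to the kernel test: the samples as bit lists. [folklore] -/
def rowsOf {m Q : ℕ} (y : Fin m → Fin Q → Bool) : List (List Bool) := List.ofFn fun i => List.ofFn (y i)

/-- **The kernel test decides `MissesBasis`** (for `m ≥ 1` samples). [cite: Simon1997, §3.1] -/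
theorem progK_rowsOf {m Q : ℕ} (hm : 1 ≤ m) (y : Fin m → Fin Q → Bool) : GF2Kernel.progK (rowsOf y) = decide (MissesBasis y) := by
  have h := GF2Kernel.progK_eq_true_iff (n := Q) (rows := rowsOf y)
    (by intro h0; have := congrArg List.length h0; simp [rowsOf] at this; omega)
    (by intro r hr; obtain ⟨i, -, rfl⟩ := List.mem_ofFn.1 hr; simp)
  rw [rowsOf, GF2Kernel.hasKernel_ofFn_iff] at h
  have e : MissesBasis y ↔ ∃ s : Fin Q → Bool, s ≠ (fun _ => false) ∧ ∀ c, Even (Finset.univ.filter fun i => s i && y c i).card := Iff.rfl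
  rw [← e] at h
  by_cases hM : MissesBasis y
  · rw [decide_eq_true hM]; exact h.2 hM
  · rw [decide_eq_false hM]; exact Bool.eq_false_iff.2 fun h' => hM (h.1 h')

end Law

end SimonSampler

end Literature.Computability.QuantumComplexity
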